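import Literature.NumberTheory.Automorphic.UnitaryLevelOneVDeepClassGuardsRamified   -- ★ p847117 (this seat): polarisation `exists_dotProduct_mulVec_ne_zero_of_transpose_eq`; brings ★ p846992 §B (`J̄N = NᵀJ̄`), ★ p846931 (`exists_eq_vecMulVec_of_rank_le_one'`), ★ p846945 (`exists_eq_sq_or_eq_sq_mul_of_not_isSquare`)
import HarnessLib

/-!
# «(O8b)-ram», dictionary file: the rank-1 depth-1 stratum has ONE SQUARE CLASS of values — `n_¬□ = n_ε`
# (the two rank-1 count sets of ★ p847154 `classOrbitalIntegral_eq_mul_sixStrata_of_vDeep_ramified` versus the (a1)∕(a2) per-vertex labels «class ±»)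

Topic `NumberTheory/Automorphic`; namespace `Literature.NumberTheory.Automorphic.UnitaryGroup`.  THEOREMS ONLY (no definition, no instance, no notation, no named fact, no `sorry`).
Hand F0P3a-p05 (g16), 2026-09-01.  Cell `pub/hodgecm-mathlib`, crux H413 = `stmt-HodgeConjecture-24833`; road «S3-ram» seeding wave (LEAD F0P3a-plan (g12); owner∕table F0P3a-p06 (g15));
architect A-p16 (g31) ROAD-P1ram v2 row «conversion» (★ p847154) — this file is its DICTIONARY for the rank-1 pair.

THE MATHEMATICS ([CollingwoodMcGovern1993] §9.3; [Rogawski1990] §4.9 p. 54, §3.9 p. 32).  (§1, any field) A SYMMETRIC matrix `S` of rank `≤ 1` is `λ·u uᵀ` in disguise: writing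
`S = v wᵀ` (★ `exists_eq_vecMulVec_of_rank_le_one'`) with `vᵢwⱼ = vⱼwᵢ`, one gets `zᵀ S z′ = (z·v)(w·z′) = (z′·v)(w·z)`, hence **`(zᵀSz)·(z′ᵀSz′) = (zᵀSz′)²`**: all NON-ZERO
values of the quadratic form `z ↦ zᵀSz` lie in ONE square class.  (§2, finite field of odd characteristic, `ε` a non-square) for symmetric `S` of rank exactly `1`:
**`¬(∃ z a, a ≠ 0 ∧ zᵀSz = a²) ↔ (∃ z a, a ≠ 0 ∧ zᵀSz = a²ε)`** (a non-zero value exists by polarisation ★ p847117; it is `a²` or `a²ε` ★ p846945; two values of different classes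
would make `ε` a square).  (§3, the CM place) at a tame-ramified `w`, for `x ∈ K′` with `x_w ≡ 1 (ϖ)` and depth-1 residue `N(x) = red(ϖ⁻¹(x_w − 1))` of rank `1`, the residual form
`S = J̄·N(x)` is symmetric (★ p846992 §B with `J̄ᵀ = J̄`) of rank `1` (`J̄` invertible), so the fifth count set of ★ p847154 («`rank N(x) = 1 ∧ ¬∃ z a, a ≠ 0 ∧ zᵀ(J̄N(x))z = a²`»)
EQUALS the set «`rank N(x) = 1 ∧ ∃ z a, a ≠ 0 ∧ zᵀ(J̄N(x))z = a²ε`» — the (a1)∕(a2) hands' label «class −» (Legendre class of any non-zero value).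
HONEST LABEL: HC_CM is proved only modulo the 2 remaining named inputs (hLiu418 24832, h413 24833) until rung 0 closes; elementary algebra, no books consequence.

## References
* [CollingwoodMcGovern1993] D. Collingwood, W. McGovern, *Nilpotent Orbits in Semisimple Lie Algebras* (1993): §9.3 (orbits by rank and square class).
* [Rogawski1990] J. D. Rogawski, *Automorphic Representations of Unitary Groups in Three Variables*, Ann. of Math. Stud. 123 (1990): §4.9 p. 54; §3.9 p. 32.
* [Wilson2009] R. A. Wilson, *The Finite Simple Groups*, GTM 251 (2009): §3.7.2 p. 71 (two square classes in `𝔽_q^×`).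
-/

set_option autoImplicit false

noncomputable section

open MeasureTheory Measure Set Filter Topology NumberField IsDedekindDomain Matrix ValuativeRel
open Literature.NumberTheory.Rogawski1990 Literature.NumberTheory.GaloisRepresentations Literature.NumberTheory.Automorphic.UnitaryGroup
open Literature.NumberTheory.Automorphic.IntegralReduction Literature.GroupTheory.SpecificGroups Literature.NumberTheory.Automorphic.UnitaryLatticeTree
open scoped Matrix MatrixGroups ValuativeRel

namespace Literature.NumberTheory.Automorphic.UnitaryGroup

/-! ## §1 One square class of values for a symmetric matrix of rank `≤ 1` (any field) -/

section Generic

variable {K : Type*} [Field K]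

/-- `zᵀ (v wᵀ) z′ = (z·v)(w·z′)`. [cite: CollingwoodMcGovern1993, §9.3] -/
theorem dotProduct_vecMulVec_mulVec {n : ℕ} (v w z z' : Fin n → K) :
    z ⬝ᵥ (vecMulVec v w *ᵥ z') = (z ⬝ᵥ v) * (w ⬝ᵥ z') := by
  rw [Matrix.vecMulVec_mulVec, dotProduct_smul, MulOpposite.smul_eq_mul_unop, MulOpposite.unop_op, mul_comm]

/-- For a SYMMETRIC `v wᵀ` (`vᵢwⱼ = vⱼwᵢ`): `(z·v)(w·z′) = (z′·v)(w·z)`. [cite: CollingwoodMcGovern1993, §9.3] -/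
theorem dotProduct_mul_dotProduct_comm_of_vecMulVec_transpose_eq {n : ℕ} {v w : Fin n → K} (h : (vecMulVec v w)ᵀ = vecMulVec v w) (z z' : Fin n → K) :
    (z ⬝ᵥ v) * (w ⬝ᵥ z') = (z' ⬝ᵥ v) * (w ⬝ᵥ z) := by
  have hij : ∀ i j, v i * w j = v j * w i := fun i j => by
    have hh := congrFun (congrFun h i) j
    rw [Matrix.transpose_apply, vecMulVec_apply, vecMulVec_apply] at hh
    exact hh.symm
  simp only [dotProduct, Finset.sum_mul_sum]
  rw [Finset.sum_comm]
  refine Finset.sum_congr rfl fun j _ => Finset.sum_congr rfl fun i _ => ?_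
  calc z i * v i * (w j * z' j) = z i * z' j * (v i * w j) := by ring
    _ = z i * z' j * (v j * w i) := by rw [hij i j]
    _ = z' j * v j * (w i * z i) := by ring

/-- **ONE SQUARE CLASS OF VALUES**: for a SYMMETRIC matrix `S` of rank `≤ 1` (size `3`), `(zᵀSz)·(z′ᵀSz′) = (zᵀSz′)²` — so all non-zero values of `z ↦ zᵀSz` lie in one class
of `K^×∕K^×²` (`S = v wᵀ` by ★ `exists_eq_vecMulVec_of_rank_le_one'`). [cite: CollingwoodMcGovern1993, §9.3] -/
theorem dotProduct_mulVec_mul_eq_sq_of_transpose_eq_of_rank_le_one {S : Matrix (Fin 3) (Fin 3) K} (hS : Sᵀ = S) (hr : S.rank ≤ 1) (z z' : Fin 3 → K) :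
    (z ⬝ᵥ (S *ᵥ z)) * (z' ⬝ᵥ (S *ᵥ z')) = (z ⬝ᵥ (S *ᵥ z')) ^ 2 := by
  obtain ⟨v, w, rfl⟩ := exists_eq_vecMulVec_of_rank_le_one' hr
  rw [dotProduct_vecMulVec_mulVec, dotProduct_vecMulVec_mulVec, dotProduct_vecMulVec_mulVec, pow_two]
  have hc := dotProduct_mul_dotProduct_comm_of_vecMulVec_transpose_eq hS z z'
  -- `(z·v)(w·z)·((z′·v)(w·z′)) = ((z·v)(w·z′))·((z·v)(w·z′))`, the second factor rewritten by `hc`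
  calc (z ⬝ᵥ v) * (w ⬝ᵥ z) * ((z' ⬝ᵥ v) * (w ⬝ᵥ z')) = ((z ⬝ᵥ v) * (w ⬝ᵥ z')) * ((z' ⬝ᵥ v) * (w ⬝ᵥ z)) := by ring
    _ = ((z ⬝ᵥ v) * (w ⬝ᵥ z')) * ((z ⬝ᵥ v) * (w ⬝ᵥ z')) := by rw [← hc]

/-- **THE TWO SPELLINGS OF «CLASS −» AGREE** over a finite field with `2 ≠ 0`: for SYMMETRIC `S` of rank exactly `1` and a non-square `ε`,
`¬(∃ z a, a ≠ 0 ∧ zᵀSz = a²) ↔ (∃ z a, a ≠ 0 ∧ zᵀSz = a²ε)` (a non-zero value exists by polarisation ★ `exists_dotProduct_mulVec_ne_zero_of_transpose_eq`; it is `a²` or `a²ε`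
★ `exists_eq_sq_or_eq_sq_mul_of_not_isSquare`; two classes at once would make `ε` a square by the one-class identity). [cite: Wilson2009, §3.7.2 p. 71] [cite: CollingwoodMcGovern1993, §9.3] -/
theorem not_exists_eq_sq_iff_exists_eq_sq_mul_of_rank_eq_one [Fintype K] (h2 : (2 : K) ≠ 0) {ε : K} (hε : ¬ IsSquare ε)
    {S : Matrix (Fin 3) (Fin 3) K} (hS : Sᵀ = S) (hr : S.rank = 1) :
    (¬ ∃ (z : Fin 3 → K) (a : K), a ≠ 0 ∧ z ⬝ᵥ (S *ᵥ z) = a ^ 2) ↔ ∃ (z : Fin 3 → K) (a : K), a ≠ 0 ∧ z ⬝ᵥ (S *ᵥ z) = a ^ 2 * ε := by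
  have hS0 : S ≠ 0 := fun h0 => by rw [h0, Matrix.rank_zero] at hr; exact zero_ne_one hr
  constructor
  · intro hno
    obtain ⟨z, hz⟩ := exists_dotProduct_mulVec_ne_zero_of_transpose_eq h2 hS hS0
    rcases exists_eq_sq_or_eq_sq_mul_of_not_isSquare hε hz with ⟨a, ha⟩ | ⟨a, ha⟩
    · exact absurd ⟨z, a, fun h0 => hz (by rw [ha, h0]; ring), by rw [ha, mul_one]⟩ hno
    · exact ⟨z, a, fun h0 => hz (by rw [ha, h0]; ring), ha⟩
  · rintro ⟨z₁, a₁, ha₁, hz₁⟩ ⟨z, a, ha, hz⟩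
    have hsq := dotProduct_mulVec_mul_eq_sq_of_transpose_eq_of_rank_le_one hS hr.le z z₁
    rw [hz, hz₁] at hsq
    -- `a² · (a₁² ε) = m²` ⇒ `ε = (m ∕ (a a₁))²`
    apply hε
    refine ⟨z ⬝ᵥ (S *ᵥ z₁) / (a * a₁), ?_⟩
    have hne : a * a₁ ≠ 0 := mul_ne_zero ha ha₁
    field_simp
    linear_combination hsq

end Generic

/-! ## §2 The CM place: the fifth count set of ★ p847154 in the «`a²ε`» spelling -/

section Place

set_option maxHeartbeats 800000 in
-- budget only: statement-heavy CM-place tokens; no search tactic runs long here.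
/-- **THE RANK-1 DEPTH-1 STRATUM HAS ONE SQUARE CLASS (tame-ramified place).**  For `x ∈ K′` with `x_w ≡ 1 (ϖ)` whose depth-1 residue `N(x) = red(ϖ⁻¹(x_w − 1))` has rank `1`,
and a residue non-square `ε`: `¬(∃ z a, a ≠ 0 ∧ zᵀ(J̄N(x))z = a²) ↔ (∃ z a, a ≠ 0 ∧ zᵀ(J̄N(x))z = a²ε)` — `J̄N(x)` is symmetric (★ p846992 §B: `J̄N = NᵀJ̄`, and `J̄ᵀ = J̄` from
`σ̄_w = id`) of rank `1` (`J̄` invertible); §1.  So ★ p847154's count set `n_¬□` is the set «class `ε`» of the (a1)∕(a2) vertex labels.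
[cite: Rogawski1990, §4.9 p. 54; §3.9 p. 32] [cite: CollingwoodMcGovern1993, §9.3] -/
theorem not_exists_depthOne_value_eq_sq_iff_exists_eq_sq_mul_ramified
    (L : Type) [Field L] [NumberField L] [IsCMField L] (H' : Matrix (Fin 3) (Fin 3) L)
    {v : HeightOneSpectrum (𝓞 ↥(maximalRealSubfield L))}
    (hH' : (H'.map (cmConjRingHom L)).transpose = H') (w : PlacesOver L v)
    (hw : IsCMField.complexConj L • w.1 = w.1) (he : v.asIdeal.ramificationIdx' w.1.asIdeal ≠ 1)
    (hH'w : IsUnit (placeForm H' w.1)) (hH'i : hH'w.unit ∈ glInt 3 (w.1.adicCompletion L))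
    (h2 : IsUnit (2 : 𝒪[(w.1.adicCompletion L)]))
    (ϖ : (w.1.adicCompletion L)) (hϖ : Valued.v ϖ = WithZero.exp (-1 : ℤ)) (hσϖ : (galAdicCompletionMap (L := L) (IsCMField.complexConj L) hw) ϖ = -ϖ)
    {ε : 𝓀[(w.1.adicCompletion L)]} (hε : ¬ IsSquare ε)
    {x : ((cmDatum L 3 H').Local v)} (hx : x ∈ (cmLocalIntegralLevel L 3 H' v)) (hx1 : (∀ a b, Valued.v (ϖ⁻¹ * ((((x).val : GL (Fin 3) (UnitaryGroup.LocalRing L v)).val.map (Pi.evalRingHom (fun w' : PlacesOver L v => w'.1.adicCompletion L) w)) a b - (1 : Matrix (Fin 3) (Fin 3) (w.1.adicCompletion L)) a b)) ≤ 1)) (hr1 : (redMat (ϖ⁻¹ • ((((x).val : GL (Fin 3) (UnitaryGroup.LocalRing L v)).val.map (Pi.evalRingHom (fun w' : PlacesOver L v => w'.1.adicCompletion L) w)) - 1))).rank = 1) :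
    (¬ ∃ (z : Fin 3 → 𝓀[(w.1.adicCompletion L)]) (a : 𝓀[(w.1.adicCompletion L)]), a ≠ 0 ∧ z ⬝ᵥ ((redMat (placeForm H' w.1) * redMat (ϖ⁻¹ • ((((x).val : GL (Fin 3) (UnitaryGroup.LocalRing L v)).val.map (Pi.evalRingHom (fun w' : PlacesOver L v => w'.1.adicCompletion L) w)) - 1))) *ᵥ z) = a ^ 2) ↔
      ∃ (z : Fin 3 → 𝓀[(w.1.adicCompletion L)]) (a : 𝓀[(w.1.adicCompletion L)]), a ≠ 0 ∧ z ⬝ᵥ ((redMat (placeForm H' w.1) * redMat (ϖ⁻¹ • ((((x).val : GL (Fin 3) (UnitaryGroup.LocalRing L v)).val.map (Pi.evalRingHom (fun w' : PlacesOver L v => w'.1.adicCompletion L) w)) - 1))) *ᵥ z) = a ^ 2 * ε := by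
  classical
  letI : Fintype 𝓀[(w.1.adicCompletion L)] := Fintype.ofFinite _
  have h2k : (2 : 𝓀[(w.1.adicCompletion L)]) ≠ 0 := by
    have h := h2.map (IsLocalRing.residue 𝒪[(w.1.adicCompletion L)])
    rw [map_ofNat] at h
    exact h.ne_zero
  -- `J̄` is symmetric and invertible
  have hJint : ∀ i j, (placeForm H' w.1) i j ∈ 𝒪[(w.1.adicCompletion L)] := fun i j => ((mem_glInt_iff _).1 hH'i).1 i j
  have hJinv : ∀ i j, (((hH'w.unit⁻¹ : (Matrix (Fin 3) (Fin 3) (w.1.adicCompletion L))ˣ) : Matrix (Fin 3) (Fin 3) (w.1.adicCompletion L))) i j ∈ 𝒪[(w.1.adicCompletion L)] :=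
    fun i j => ((mem_glInt_iff _).1 hH'i).2 i j
  have hJbardet : IsUnit (redMat (placeForm H' w.1)).det := by
    let JO : Matrix (Fin 3) (Fin 3) 𝒪[(w.1.adicCompletion L)] := Matrix.of fun i j => ⟨(placeForm H' w.1) i j, hJint i j⟩
    have hJ : (placeForm H' w.1) = JO.map ((↑) : 𝒪[(w.1.adicCompletion L)] → (w.1.adicCompletion L)) := by ext i j; rfl
    have hinjO : Function.Injective (fun M : Matrix (Fin 3) (Fin 3) 𝒪[(w.1.adicCompletion L)] => M.map ((↑) : 𝒪[(w.1.adicCompletion L)] → (w.1.adicCompletion L))) :=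
      Matrix.map_injective Subtype.val_injective
    have hJOdet : IsUnit JO.det := by
      let JI : Matrix (Fin 3) (Fin 3) 𝒪[(w.1.adicCompletion L)] :=
        Matrix.of fun i j => ⟨(((hH'w.unit⁻¹ : (Matrix (Fin 3) (Fin 3) (w.1.adicCompletion L))ˣ) : Matrix (Fin 3) (Fin 3) (w.1.adicCompletion L))) i j, hJinv i j⟩
      have hJI : (((hH'w.unit⁻¹ : (Matrix (Fin 3) (Fin 3) (w.1.adicCompletion L))ˣ) : Matrix (Fin 3) (Fin 3) (w.1.adicCompletion L))) = JI.map ((↑) : 𝒪[(w.1.adicCompletion L)] → (w.1.adicCompletion L)) := by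
        ext i j; rfl
      have hmul : JO * JI = 1 := by
        apply hinjO
        change (JO * JI).map ⇑(𝒪[(w.1.adicCompletion L)]).subtype = (1 : Matrix (Fin 3) (Fin 3) 𝒪[(w.1.adicCompletion L)]).map ⇑(𝒪[(w.1.adicCompletion L)]).subtype
        rw [Matrix.map_mul, Matrix.map_one (𝒪[(w.1.adicCompletion L)]).subtype (map_zero _) (map_one _)]
        change JO.map ((↑) : 𝒪[(w.1.adicCompletion L)] → (w.1.adicCompletion L)) * JI.map ((↑) : 𝒪[(w.1.adicCompletion L)] → (w.1.adicCompletion L)) = 1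
        rw [← hJ, ← hJI]
        have hmi := hH'w.unit.mul_inv
        rw [hH'w.unit_spec] at hmi
        exact hmi
      exact Matrix.isUnit_det_of_right_inverse hmul
    have hJred : redMat (placeForm H' w.1) = JO.map (IsLocalRing.residue 𝒪[(w.1.adicCompletion L)]) := by rw [hJ]; exact redMat_mapMatrix JO
    rw [hJred, ← RingHom.mapMatrix_apply, ← RingHom.map_det]
    exact hJOdet.map _
  have hJbT : (redMat (placeForm H' w.1))ᵀ = redMat (placeForm H' w.1) := by
    have hJσ : (((placeForm H' w.1)).map (galAdicCompletionMap (L := L) (IsCMField.complexConj L) hw))ᵀ = (placeForm H' w.1) := placeForm_hermitian_of_smul_eq (c := IsCMField.complexConj L) w H' hH' hw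
    have hT : ((placeForm H' w.1))ᵀ = ((placeForm H' w.1)).map (galAdicCompletionMap (L := L) (IsCMField.complexConj L) hw) := by
      conv_lhs => rw [← hJσ]
      rw [Matrix.transpose_transpose]
    rw [← redMat_transpose, hT]
    exact redMat_map_galAdicCompletionMap_eq_of_ramified L v w hw he hJint
  -- `S = J̄ N(x)` is symmetric of rank `1`
  have hsym := redMat_placeForm_mul_depthOne_eq_transpose_mul_of_ramified L H' w hw he hH'w hH'i ϖ hϖ hσϖ hx hx1
  have hST : (redMat (placeForm H' w.1) * redMat (ϖ⁻¹ • ((((x).val : GL (Fin 3) (UnitaryGroup.LocalRing L v)).val.map (Pi.evalRingHom (fun w' : PlacesOver L v => w'.1.adicCompletion L) w)) - 1)))ᵀ = redMat (placeForm H' w.1) * redMat (ϖ⁻¹ • ((((x).val : GL (Fin 3) (UnitaryGroup.LocalRing L v)).val.map (Pi.evalRingHom (fun w' : PlacesOver L v => w'.1.adicCompletion L) w)) - 1)) := by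
    rw [Matrix.transpose_mul, hJbT, ← hsym]
  have hSr : (redMat (placeForm H' w.1) * redMat (ϖ⁻¹ • ((((x).val : GL (Fin 3) (UnitaryGroup.LocalRing L v)).val.map (Pi.evalRingHom (fun w' : PlacesOver L v => w'.1.adicCompletion L) w)) - 1))).rank = 1 := by
    rw [Matrix.rank_mul_eq_right_of_isUnit_det _ _ hJbardet, hr1]
  exact not_exists_eq_sq_iff_exists_eq_sq_mul_of_rank_eq_one h2k hε hST hSr

end Place

end Literature.NumberTheory.Automorphic.UnitaryGroup

end
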